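import Summits.AnomalousDissipation.AnomalousDissipation.Theorems.SawtoothPulseCascadeK1LocalisedCascadeCanonicalStripStepsLog2
import Summits.AnomalousDissipation.AnomalousDissipation.Theorems.SawtoothPulseCascadeK1LocalisedCascadeCanonicalBlocksMax

/-!
# K1loc, line `Spectral` / thin start — helper: THE (S-V) STEP ALONG THE FAT SCHEDULE `K_j = K₀·25^j` (numeric layer)

Helper file of the prover lane on the crux `K1LocalisedCascade` (stmt-AnomalousDissipation-19491), route `SawtoothPulseCascade`
(S-B/S-C assembly seat; the LEDGER ASSEMBLY, numeric layer; companion of `…PhaseTH`).  The strip step (S-V) along the fat schedule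
`K_j = K₀·25^j` (`K₀ ≥ 6`): window `K_{j+1} = 25K_j`, low fibres `|k₁| < 5K_j = K′_j` exact, canonical blocks `Λ_m = 5K_j·2^m` with
margin `β = 2`, `max`-family cut-offs with slope `t = 2/3` and feed threshold `Y₀ = 3K_j` (feed = the sub-cone class
`C_j = Σ'[3K_j + 1 ≤ |k₀| ∧ |k₁| ≤ 3|k₀|]‖𝓕b_j‖²`), `M_b = 7j + 19`, `η_j = (ε/(A₃·8π·2^19·5K₀))·1600^{−j}`, Log2 grade:
  `S_{j+1}(25K_j) ≤ T_j(5K_j) + ((√J_S(j) + √C_j)² + ((1+γ)^{2(j+1)}/(5K_j·2^{7j+19}))²)`,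
  `J_S(j) = 3·r₃²·((4/3)ε² + 64·2^j·A₃/(5K_j) + 8(7j+19)·A₃²·(M_jδ_j)/π)`, `r₃ = 4/π + (2/π)log(81/39) + 1/39 + 1/(39²π)`,
  `A₃ = 4/π + (2/π)log 15 + 1/30 + 1/(900π)`.
No definitions; no statement about the crux. [cite: Grafakos2014, Prop. 3.1.2 (5), Prop. 3.2.7 (3), §3.1.3]
[cite: ElgindiLissMattingly2025, §1 (slope ±1 branches)] [problem: turb]
-/

-- `Summit.<Summit>.<Problem>`: single-conjunct summit, the duplicate namespace segment is deliberate.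
set_option linter.dupNamespace false

noncomputable section

namespace Summit.AnomalousDissipation.AnomalousDissipation.Theorems.SawtoothPulseCascade.K1Window

open MeasureTheory Set Filter Topology UnitAddTorus Function Complex Metric
open scoped Real ENNReal
open Literature.Analysis Literature.Analysis.FunctionSpaces Literature.Analysis.FunctionSpaces.Torus Literature.Analysis.FluidPDE
open Literature.Analysis.FluidPDE.ShearStage
open Literature.Analysis.FluidPDE.SawtoothCascade Literature.Analysis.FluidPDE.SawtoothCascade.CascadeParams
open Summit.AnomalousDissipation.AnomalousDissipation.Theorems.SawtoothPulseCascade.K1Start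
open Summit.AnomalousDissipation.AnomalousDissipation.Theorems.SawtoothPulseCascade.K1Flat
open Summit.AnomalousDissipation.AnomalousDissipation.Theorems.SawtoothPulseCascade.K1Ledger.From

/-- **The log cut-off ratio of the fat (S-V) blocks is at most `r₃ = 4/π + (2/π)log(81/39) + 1/39 + 1/(39²π)`** (max family,
`t = 2/3` with `3Y₀ ≤ 2Λ₀`, `β = 2`, `Λ₀ ≥ 30`: `r* ≤ 81/39`, gap `≥ 39`). [folklore] -/
theorem strip_logCutoff_le {Λ0 Y₀ : ℕ} (hΛ0 : 30 ≤ Λ0) (hY₀ : Y₀ * 3 ≤ 2 * Λ0) (m : ℕ) :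
    4 / π + 2 / π * Real.log ((((max (2 * 1 * (Λ0 * 2 ^ m) / 3) Y₀ : ℕ) : ℝ) + ((2 * (Λ0 * 2 ^ m) / 1 : ℕ) : ℝ)) /
        (((2 * (Λ0 * 2 ^ m) / 1 : ℕ) : ℝ) - ((max (2 * 1 * (Λ0 * 2 ^ m) / 3) Y₀ : ℕ) : ℝ))) +
      1 / (((2 * (Λ0 * 2 ^ m) / 1 : ℕ) : ℝ) - ((max (2 * 1 * (Λ0 * 2 ^ m) / 3) Y₀ : ℕ) : ℝ)) +
      1 / (π * (((2 * (Λ0 * 2 ^ m) / 1 : ℕ) : ℝ) - ((max (2 * 1 * (Λ0 * 2 ^ m) / 3) Y₀ : ℕ) : ℝ)) ^ 2) ≤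
    4 / π + 2 / π * Real.log (81 / 39) + 1 / 39 + 1 / (π * 39 ^ 2) := by
  have h1 : 2 * 1 * 3 ≤ 2 * 3 := by norm_num
  have h3 : 2 * 1 * Λ0 + 2 * 1 * 3 ≤ 2 * 3 * Λ0 := by omega
  have hQ := canonMax_Q₁_lt_Q₂ (u' := 1) (v' := 3) (Y₀ := Y₀) (tn := 2) (td := 3) (qn := 2) (qd := 1) (Λ0 := Λ0)
    (by norm_num) (by norm_num) (by norm_num) h1 hY₀ h3 m
  have hr := canonMax_r_le (u' := 1) (v' := 3) (Y₀ := Y₀) (tn := 2) (td := 3) (qn := 2) (qd := 1) (Λ0 := Λ0)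
    (by norm_num) (by norm_num) (by norm_num) h1 hY₀ h3 m
  have hgap := canonMax_gap_le (u' := 1) (v' := 3) (Y₀ := Y₀) (tn := 2) (td := 3) (qn := 2) (qd := 1) (Λ0 := Λ0)
    (by norm_num) (by norm_num) (by norm_num) h1 hY₀ h3 m
  have hΛ0r : (30 : ℝ) ≤ Λ0 := by exact_mod_cast hΛ0
  have hden : (0 : ℝ) < (((2 : ℕ) : ℝ) / ((1 : ℕ) : ℝ) - ((2 : ℕ) : ℝ) / ((3 : ℕ) : ℝ)) * (Λ0 : ℝ) - 1 := by
    push_cast; linarith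
  have hrs2 : ((((2 : ℕ) : ℝ) / ((3 : ℕ) : ℝ) + ((2 : ℕ) : ℝ) / ((1 : ℕ) : ℝ)) * (Λ0 : ℝ) + 1) /
      ((((2 : ℕ) : ℝ) / ((1 : ℕ) : ℝ) - ((2 : ℕ) : ℝ) / ((3 : ℕ) : ℝ)) * (Λ0 : ℝ) - 1) ≤ 81 / 39 := by
    rw [div_le_iff₀ hden]
    push_cast; linarith
  have hgap8 : (39 : ℝ) ≤ (((2 : ℕ) : ℝ) / ((1 : ℕ) : ℝ) - ((2 : ℕ) : ℝ) / ((3 : ℕ) : ℝ)) * (Λ0 : ℝ) - 1 := by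
    push_cast; linarith
  have h := logCutoff_le_of_gap hQ hr (by norm_num : (0 : ℝ) < 39) (hgap8.trans hgap)
  refine h.trans ?_
  have hpos : 0 < ((((2 : ℕ) : ℝ) / ((3 : ℕ) : ℝ) + ((2 : ℕ) : ℝ) / ((1 : ℕ) : ℝ)) * (Λ0 : ℝ) + 1) /
      ((((2 : ℕ) : ℝ) / ((1 : ℕ) : ℝ) - ((2 : ℕ) : ℝ) / ((3 : ℕ) : ℝ)) * (Λ0 : ℝ) - 1) := by
    refine div_pos ?_ hden
    push_cast; linarith
  exact logKernel_mono hpos hrs2 (by norm_num) le_rfl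

section Cascade

variable (P : CascadeParams)

set_option maxHeartbeats 400000 in
/-- **(S-V) ALONG THE FAT SCHEDULE** (see the file header): for every phase `j`, with `K_j = K₀·25^j`, `K₀ ≥ 6`,
`S_{j+1}(25K_j) ≤ T_j(5K_j) + ((√J_S(j) + √C_j)² + ((1+γ)^{2(j+1)}/(5K_j2^{7j+19}))²)`. [cite: Grafakos2014, Prop. 3.1.2 (5), Prop. 3.2.7 (3), §3.1.3] -/
theorem strip_vstep_fat_le (hγ : P.γ = 8) (hδ₀ : 0 < P.δ₀) (hd : P.d = 2) (hN₀ : P.N₀ = 1) (hρN : P.ρN = 2)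
    (a b : ℕ → UnitAddTorus (Fin 2) → ℝ) (has : ∀ j, IsSmooth (a j)) (h0 : a 0 = datum)
    (hb : ∀ j, b j = a j ∘ shearMap 0 1 (amp ⟨P.U j, P.U_periodic j, P.contDiff_U (P.δ_pos hδ₀ (by rw [hd]; norm_num) j)⟩ P.γ))
    (hab : ∀ j, a (j + 1) = b j ∘ shearMap 1 0 (amp ⟨P.U j, P.U_periodic j, P.contDiff_U (P.δ_pos hδ₀ (by rw [hd]; norm_num) j)⟩ P.γ))
    {K₀ : ℕ} (hK₀ : 6 ≤ K₀) {ε : ℝ} (hε : 0 < ε) (j : ℕ)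
    (hMδ : max 1 (Real.sqrt (2 * Real.log (1 / (ε / ((4 / π + 2 / π * Real.log 15 + 1 / 30 + 1 / (π * 30 ^ 2)) * π * 8 *
        2 ^ 19 * ((5 * K₀ : ℕ) : ℝ)) * (1 / 1600) ^ j)))) * P.δ j < π / 2) :
    ∑' k : Fin 2 → ℤ, (if |k 0| < ((25 * (K₀ * 25 ^ j) : ℕ) : ℤ) then (1 : ℝ) else 0) *
        ‖mFourierCoeff (fun x => (a (j + 1) x : ℂ)) k‖ ^ 2 ≤
      ∑' k : Fin 2 → ℤ, (if |k 1| < ((5 * (K₀ * 25 ^ j) : ℕ) : ℤ) then (1 : ℝ) else 0) * ‖mFourierCoeff (fun x => (b j x : ℂ)) k‖ ^ 2 +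
      ((Real.sqrt (3 * (4 / π + 2 / π * Real.log (81 / 39) + 1 / 39 + 1 / (π * 39 ^ 2)) ^ 2 *
            (4 / 3 * ε ^ 2 + 64 * 2 ^ j * (4 / π + 2 / π * Real.log 15 + 1 / 30 + 1 / (π * 30 ^ 2)) / ((5 * (K₀ * 25 ^ j) : ℕ) : ℝ) +
              8 * ((7 * j + 19 : ℕ) : ℝ) * (4 / π + 2 / π * Real.log 15 + 1 / 30 + 1 / (π * 30 ^ 2)) ^ 2 *
                (max 1 (Real.sqrt (2 * Real.log (1 / (ε / ((4 / π + 2 / π * Real.log 15 + 1 / 30 + 1 / (π * 30 ^ 2)) * π * 8 *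
                  2 ^ 19 * ((5 * K₀ : ℕ) : ℝ)) * (1 / 1600) ^ j)))) * P.δ j) / π)) +
          Real.sqrt (∑' k : Fin 2 → ℤ, (if ((3 * (K₀ * 25 ^ j) + 1 : ℕ) : ℤ) ≤ |k 0| ∧ ((1 : ℕ) : ℤ) * |k 1| ≤ ((3 : ℕ) : ℤ) * |k 0|
            then (1 : ℝ) else 0) * ‖mFourierCoeff (fun x => (b j x : ℂ)) k‖ ^ 2)) ^ 2 +
        ((1 + P.γ) ^ (2 * (j + 1)) / (((5 * (K₀ * 25 ^ j)) * 2 ^ (7 * j + 19) : ℕ) : ℝ)) ^ 2) := by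
  -- the schedule and the shape
  set Kj : ℕ := K₀ * 25 ^ j with hKjdef
  have hKj6 : 6 ≤ Kj := hK₀.trans (Nat.le_mul_of_pos_right _ (pow_pos (by norm_num) j))
  set Λ0 : ℕ := 5 * Kj with hΛ0def
  have hΛ06 : 30 ≤ Λ0 := by rw [hΛ0def]; omega
  have hΛ01 : 1 ≤ Λ0 := le_trans (by norm_num) hΛ06
  have hΛ0r : (30 : ℝ) ≤ Λ0 := by exact_mod_cast hΛ06
  have hKjr : (0 : ℝ) < Kj := by exact_mod_cast (lt_of_lt_of_le (by norm_num) hKj6)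
  have hΛ0pos : (0 : ℝ) < Λ0 := by linarith
  have hγ' : P.γ = ((8 : ℕ) : ℝ) := by rw [hγ]; norm_num
  have hd' : 0 < P.d := by rw [hd]; norm_num
  have hN₀' : 1 ≤ P.N₀ := by rw [hN₀]
  have hρN' : 1 ≤ P.ρN := by rw [hρN]; norm_num
  have hNj : (P.N j : ℝ) = 2 ^ j := by rw [CascadeParams.N, hN₀, hρN]; push_cast; ring
  have hK : 25 * Kj * 1 + 2 * Λ0 < 8 * 1 * Λ0 := by rw [hΛ0def]; omega
  -- the `max`-family cut-offs
  have h1 : 2 * 1 * 3 ≤ 2 * 3 := by norm_num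
  have h2 : (3 * Kj) * 3 ≤ 2 * Λ0 := by rw [hΛ0def]; omega
  have h3 : 2 * 1 * Λ0 + 2 * 1 * 3 ≤ 2 * 3 * Λ0 := by omega
  set A₀ : ℝ := 4 / π + 2 / π * Real.log 15 + 1 / 30 + 1 / (π * 30 ^ 2) with hA₀
  set r₀ : ℝ := 4 / π + 2 / π * Real.log (81 / 39) + 1 / 39 + 1 / (π * 39 ^ 2) with hr₀
  set η : ℝ := ε / (A₀ * π * 8 * 2 ^ 19 * ((5 * K₀ : ℕ) : ℝ)) * (1 / 1600) ^ j with hη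
  have hπ := Real.pi_pos
  have hlog15 : 0 ≤ Real.log 15 := Real.log_nonneg (by norm_num)
  have hA₀pos : 0 < A₀ := by rw [hA₀]; positivity
  have hK₀r : (6 : ℝ) ≤ K₀ := by exact_mod_cast hK₀
  have hηpos : 0 < η := by rw [hη]; positivity
  -- the packaged step
  have hstep := strip_vstep_canonicalLog2_le P hγ' hδ₀ hd' hN₀' hρN' a b has h0 hb hab j (K := 25 * Kj)
    (u' := 1) (v' := 3) (Y := 3 * Kj + 1) (qn := 2) (qd := 1) (Λ0 := Λ0) (by norm_num) hK hΛ01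
    (fun m => max (2 * 1 * (Λ0 * 2 ^ m) / 3) (3 * Kj))
    (fun m => canonMax_Q₁_lt_Q₂ (by norm_num) (by norm_num) (by norm_num) h1 h2 h3 m)
    (fun m => canonMax_feed (by norm_num) (3 * Kj) Λ0 m) (rs := r₀) (fun m => strip_logCutoff_le hΛ06 h2 m)
    (fun m => canonMax_Y 1 3 (3 * Kj) Λ0 m) (7 * j + 19) hηpos hMδ
  -- the exact constants of the canonical step at `K = 5Λ₀`, `q = 2/1`, `G = 8`
  have eratio : ((((25 * Kj : ℕ) : ℝ)) * ((1 : ℕ) : ℝ) + (((2 : ℕ) : ℝ) + ((8 : ℕ) : ℝ) * ((1 : ℕ) : ℝ)) * Λ0) /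
      ((((8 : ℕ) : ℝ) * ((1 : ℕ) : ℝ) - ((2 : ℕ) : ℝ)) * Λ0 - ((25 * Kj : ℕ) : ℝ) * ((1 : ℕ) : ℝ)) = 15 := by
    rw [hΛ0def]; push_cast; field_simp; ring
  have eD : ((((8 : ℕ) : ℝ) * ((1 : ℕ) : ℝ) - ((2 : ℕ) : ℝ)) * Λ0 - ((25 * Kj : ℕ) : ℝ) * ((1 : ℕ) : ℝ)) / ((1 : ℕ) : ℝ) =
      Λ0 := by
    rw [hΛ0def]; push_cast; ring
  have eτ : ((1 : ℕ) : ℝ) / (2 * ((((8 : ℕ) : ℝ) * ((1 : ℕ) : ℝ) - ((2 : ℕ) : ℝ)) * Λ0 - ((25 * Kj : ℕ) : ℝ) * ((1 : ℕ) : ℝ))) =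
      1 / (2 * (Λ0 : ℝ)) := by
    rw [hΛ0def]; push_cast; ring
  set As : ℝ := 4 / π + 2 / π * Real.log ((((25 * Kj : ℕ) : ℝ) * ((1 : ℕ) : ℝ) + (((2 : ℕ) : ℝ) + ((8 : ℕ) : ℝ) * ((1 : ℕ) : ℝ)) * Λ0) /
      ((((8 : ℕ) : ℝ) * ((1 : ℕ) : ℝ) - ((2 : ℕ) : ℝ)) * Λ0 - ((25 * Kj : ℕ) : ℝ) * ((1 : ℕ) : ℝ))) +
      1 / (((((8 : ℕ) : ℝ) * ((1 : ℕ) : ℝ) - ((2 : ℕ) : ℝ)) * Λ0 - ((25 * Kj : ℕ) : ℝ) * ((1 : ℕ) : ℝ)) / ((1 : ℕ) : ℝ)) +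
      1 / (π * (((((8 : ℕ) : ℝ) * ((1 : ℕ) : ℝ) - ((2 : ℕ) : ℝ)) * Λ0 - ((25 * Kj : ℕ) : ℝ) * ((1 : ℕ) : ℝ)) / ((1 : ℕ) : ℝ)) ^ 2)
    with hAs
  have hAsle : As ≤ A₀ := by
    rw [hAs, eratio, eD, hA₀]
    have h6 : 1 / (Λ0 : ℝ) ≤ 1 / 30 := one_div_le_one_div_of_le (by norm_num) hΛ0r
    have h36 : 1 / (π * (Λ0 : ℝ) ^ 2) ≤ 1 / (π * 30 ^ 2) :=
      one_div_le_one_div_of_le (by positivity) (mul_le_mul_of_nonneg_left (pow_le_pow_left₀ (by norm_num) hΛ0r 2) hπ.le)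
    linarith
  have hAs0 : 0 ≤ As := by
    rw [hAs, eratio, eD]
    positivity
  set Mδ : ℝ := max 1 (Real.sqrt (2 * Real.log (1 / η))) * P.δ j with hMδdef
  have hMδ0 : 0 ≤ Mδ := by
    rw [hMδdef]
    exact mul_nonneg (le_trans zero_le_one (le_max_left _ _)) (P.δ_pos hδ₀ hd' j).le
  refine le_add_sq_sqrt_add_mono hstep ?_
  -- the junk: `As ≤ A₀`, `τ₀ = 1/(2Λ₀)`, `N_j = 2^j`, the rounding product collapses to `As·ε/A₀ ≤ ε`
  rw [eτ, hNj]
  have hX : As * π * ((8 : ℕ) : ℝ) * η * Λ0 / 2 ^ j * 2 ^ (7 * j + 19) = As * (ε / A₀) := by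
    have e2 : (2 : ℝ) ^ (7 * j + 19) = 2 ^ 19 * 128 ^ j := by
      rw [pow_add, pow_mul]; norm_num; ring
    have p1 : ((1 : ℝ) / 1600) ^ j * (25 : ℝ) ^ j * (128 : ℝ) ^ j = (2 : ℝ) ^ j := by
      rw [← mul_pow, ← mul_pow]; norm_num
    have eΛ : (Λ0 : ℝ) = 5 * (K₀ : ℝ) * 25 ^ j := by rw [hΛ0def, hKjdef]; push_cast; ring
    have e5 : ((5 * K₀ : ℕ) : ℝ) = 5 * (K₀ : ℝ) := by push_cast; ring
    have hne1 : Real.pi * 8 * 2 ^ 19 * (5 * (K₀ : ℝ)) ≠ 0 := by positivity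
    have hne2 : (2 : ℝ) ^ j ≠ 0 := pow_ne_zero _ two_ne_zero
    have hne3 : A₀ ≠ 0 := hA₀pos.ne'
    rw [hη, e2, eΛ, e5]
    push_cast
    calc As * π * 8 * (ε / (A₀ * π * 8 * 2 ^ 19 * (5 * (K₀ : ℝ))) * (1 / 1600) ^ j) * (5 * (K₀ : ℝ) * 25 ^ j) / 2 ^ j *
          (2 ^ 19 * 128 ^ j)
        = As * (ε / A₀) * ((Real.pi * 8 * 2 ^ 19 * (5 * (K₀ : ℝ))) / (Real.pi * 8 * 2 ^ 19 * (5 * K₀))) *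
            ((((1 : ℝ) / 1600) ^ j * 25 ^ j * 128 ^ j) / 2 ^ j) := by
          field_simp
      _ = As * (ε / A₀) := by rw [p1, div_self hne1, div_self hne2]; ring
  have hXle : As * π * ((8 : ℕ) : ℝ) * η * Λ0 / 2 ^ j * 2 ^ (7 * j + 19) ≤ ε := by
    rw [hX]
    calc As * (ε / A₀) ≤ A₀ * (ε / A₀) := mul_le_mul_of_nonneg_right hAsle (by positivity)
      _ = ε := by field_simp
  have hX0 : 0 ≤ As * π * ((8 : ℕ) : ℝ) * η * Λ0 / 2 ^ j * 2 ^ (7 * j + 19) := by rw [hX]; positivity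
  have hr₀0 : 0 ≤ 3 * r₀ ^ 2 := by positivity
  refine mul_le_mul_of_nonneg_left ?_ hr₀0
  refine add_le_add (add_le_add ?_ ?_) ?_
  · exact mul_le_mul_of_nonneg_left (pow_le_pow_left₀ hX0 hXle 2) (by norm_num)
  · -- kernel layer: `128·2^j·As·(1/(2Λ₀)) ≤ 64·2^j·A₀/Λ₀`
    have h2j : (0 : ℝ) ≤ 2 ^ j := by positivity
    rw [show (128 : ℝ) * 2 ^ j * As * (1 / (2 * (Λ0 : ℝ))) = 64 * 2 ^ j * As / Λ0 by field_simp; ring]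
    exact div_le_div_of_nonneg_right (mul_le_mul_of_nonneg_left hAsle (by positivity)) hΛ0pos.le
  · -- zone part: `As² ≤ A₀²`
    have : As ^ 2 ≤ A₀ ^ 2 := pow_le_pow_left₀ hAs0 hAsle 2
    have hMb : (0 : ℝ) ≤ ((7 * j + 19 : ℕ) : ℝ) := by positivity
    have := mul_le_mul_of_nonneg_left (mul_le_mul_of_nonneg_right this hMδ0) (by positivity : (0 : ℝ) ≤ 8 * ((7 * j + 19 : ℕ) : ℝ))
    have e : ∀ A : ℝ, 8 * ((7 * j + 19 : ℕ) : ℝ) * A ^ 2 * Mδ / π = 8 * ((7 * j + 19 : ℕ) : ℝ) * (A ^ 2 * Mδ) / π := fun A => by ring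
    rw [e, e]
    exact div_le_div_of_nonneg_right this hπ.le

end Cascade

end Summit.AnomalousDissipation.AnomalousDissipation.Theorems.SawtoothPulseCascade.K1Window
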